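import Literature.Analysis.FluidPDE.CompressibleEulerImplosion
import HarnessLib

/-!
# The Cao-Labora–Gómez-Serrano–Shi–Staffilani implosion on `𝕋³` together with its self-similar
rates (named fact)

Topic `Literature/Analysis/FluidPDE`; namespace `Literature.Analysis.FluidPDE`. Companion of
`CompressibleEulerImplosion.lean`, whose named fact `CaolaboraEtAl2025_thm12_euler γ` records the
RATE-FREE corollary (a classical isentropic solution on `[0,T) × 𝕋³` with unbounded density) of

  G. Cao-Labora, J. Gómez-Serrano, J. Shi, G. Staffilani, *Non-radial implosion for compressible
  Euler and Navier–Stokes in `𝕋³` and `ℝ³`*, Camb. J. Math. 13 (2025) 753–885, arXiv:2310.05325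
  (bib `CaolaboraEtAl2025`; held text, per-page files `p0001 … p0053`, pages below are those),

Theorem 1.2 + Remarks 1.4–1.5, with the `γ = 5/3` profile of Buckmaster–Cao-Labora–Gómez-Serrano
(arXiv:2208.09445, bib `BuckmasterCaolaboraGomezserrano2025`, quoted on p. 6 of the source). The
hard-sphere route `ImplosionDichotomy` of `AtomisticToContinuum/HydrodynamicLimit` (crux
`PolynomialCompression`, stub `stub_typeOneImplosion` of its line `log-lipschitz-budget`) consumes
four QUANTITATIVE by-products of the same construction which the corollary dropped: Type-I
(`C/(T−t)`) bounds on the first derivatives of `u` and of the sound speed `∝ ρ^{1/3}`, polynomial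
(in `(T−t)⁻¹`) bounds on all derivatives of order `≤ 6`, a polynomial lower bound on the density,
and the growth of the core density at the self-similar rate `(T−t)^{−3(1−1/r)}`. This file states
them, for `γ = 5/3` (`α = (γ−1)/2 = 1/3`), as ONE named fact `CaolaboraEtAl2025_thm12_rates`, in the
vocabulary of `CompressibleEulerImplosion.lean` (`IsIsentropicEulerSolution`, torus calculus of
`Literature.Analysis.FunctionSpaces.Torus`, Mathlib `iteratedFDeriv` of the periodic lift).

## Where each clause is in the source (derivations in the docstring of the fact)

* self-similar variables, §1.3 "Setup of the problem", p. 5: `α = (γ−1)/2`, `σ = α⁻¹ρ^α`,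
  `u(x,t) = r⁻¹(T−t)^{1/r−1} U(x/(T−t)^{1/r}, s)`, `σ(x,t) = r⁻¹(T−t)^{1/r−1} S(x/(T−t)^{1/r}, s)`,
  `s = −log(T−t)/r`, `y = x/(T−t)^{1/r} = eˢx`, `r > 1`;
* Theorem 1.2 p. 6, Remark 1.4 p. 6 (any torus size by scaling), Remark 1.5 p. 7 (Euler, `ν = 0`);
  profile properties (1.5) `S̄ > 0` and (1.6) `|∇ʲŪ| + |∇ʲS̄| ≲ ⟨R⟩^{−(r−1)−j}` (all `j ≥ 0`), p. 6;
* Proposition 3.3 p. 25 (the bootstrap: `|Ũ|, |S̃| ≤ δ₀C₂⁻¹e^{−ε(s−s₀)}`, `Ḣ⁴` control outside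
  `B(0,C₀)`, `E_K = ∫(|∇ᴷU|² + |∇ᴷS|²)φᴷ ≤ E`), the parameter hierarchy of §3.2, p. 23
  (`1/s₀ ≪ δ₀^{3/2} ≪ δ₁ ≪ δ₀ ≪ 1/E ≪ ε̄ ≪ 1/K ≪ 1/m ≪ η ≪ δ_g ≪ δ_dis`, so `K` is large), the
  weight `φ ≡ 1` on `|y| ≤ R₀`, `φ ≍ |y|^{2(1−η)}` at infinity, p. 24; and p. 40 (end of the
  proof of Thm 1.2, after Prop. 3.15): "For such initial data we are under the hypothesis of
  Proposition 3.3 for all `s₁ ≥ s₀`", followed by the return to physical variables;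
* Lemma 3.5 p. 25 ("Bounds for `S`": `S ≳ δ₁⟨R/R₀⟩^{−(r−1)}`), Lemma 3.6 p. 26
  (`|∇S| + |∇U| ≲ ⟨R/R₀⟩^{−r}`, unweighted, uniformly in `s`), Lemma 3.7 p. 27
  (`|∇ʲU| + |∇ʲS| ≲_{δ₀,ε̄} ⟨R⟩^{−j(1−η)−(r−1)+ε̄}` for `1 ≤ j ≤ K−2`), all proved under the
  bootstrap assumptions of Prop. 3.3 via the weighted Gagliardo–Nirenberg inequalities of the
  Appendix (Lemmas 4.4–4.6, pp. 50–52).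

## What is deliberately NOT here

The finite-codimension stability statement, the Navier–Stokes case `ν = 1`, general `γ > 1`,
`𝕋³_L` / `ℝ³` (Thm 1.3), and the full self-similar asymptotics of Thm 1.2 (only its consequence at
`y = 0` is kept, as the core-growth clause). Nothing is asserted: users take
`(h : CaolaboraEtAl2025_thm12_rates)`.
-/

noncomputable section

open Set

namespace Literature.Analysis.FluidPDE

open Literature.MathematicalPhysics.KineticTheory (T3 V3)

/-- NAMED FACT — **the CGSS self-similar implosion of the monatomic ideal gas on `𝕋³`, with its
rates** (Cao-Labora–Gómez-Serrano–Shi–Staffilani, arXiv:2310.05325 = Camb. J. Math. 13 (2025)).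

Printed statements (pages of the held text). Theorem 1.2, p. 6: "Let `ν = 1`. Let `Ū, S̄` be
self-similar profiles solving [the profile system] and satisfying [the four profile properties
displayed on p. 6: (1.5) `S̄ > 0`, (1.6) `|∇ʲŪ| + |∇ʲS̄| ≲ ⟨R⟩^{−(r−1)−j}` for all `j ≥ 0` and
`S̄ ≳ ⟨R⟩^{−r+1}`, radial and angular repulsivity], for some `r` in the ranges [`1 < r < r*(γ)`
of §1.3 p. 5], [`δ_dis = (r−1)/α + r − 2 > 0`]. Let `T > 0` sufficiently small, and `L > 0`
sufficiently large. Then, there exists `C^∞` initial data `(u₀, ρ₀)`, with `ρ₀ > 0`, for which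
equation (1.1) on `𝕋³_L` blows up at time `T` in a self-similar manner. More concretely, for
any fixed `y ∈ ℝ³`, we have: `lim_{t→T⁻} r(T−t)^{1−1/r} u((T−t)^{1/r}y, t) = Ū(|y|)`,
`lim_{t→T⁻} (α⁻¹r(T−t)^{1−1/r})^{1/α} ρ((T−t)^{1/r}y, t) = S̄(|y|)^{1/α}`. Moreover, there exists
a finite codimension set of initial data satisfying the above conclusions." Remark 1.4, p. 6:
"[by the scaling `u_λ(x,t) = λ^{−α}u(x/λ^{α+1}, t/λ^{2α+1})`,
`ρ_λ(x,t) = λ^{−1}ρ(x/λ^{α+1}, t/λ^{2α+1})`] we can generalize Theorem 1.2 for any torus size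
`2L'` (not necessarily large)". Remark 1.5, p. 7: "Both results hold also for the Euler case,
`ν = 0`. Moreover, in such a case, condition [`δ_dis > 0`] is not needed. … The proof is
analogous to the Navier–Stokes one, except that one does not need to bound the dissipation term
when doing energy estimates." Profiles: p. 6, "[Buckmaster–Cao-Labora–Gómez-Serrano] gives the
existence of profiles … for all `γ > 1`, including `γ = 5/3`. Moreover, all the profiles
discussed above satisfy [the four properties]".

The solution of Thm 1.2 IS the self-similar ansatz of §1.3 (p. 5): with `α = (γ−1)/2` (`= 1/3`
here), `σ = α⁻¹ρ^α` (`= 3ρ^{1/3}`), `s = −log(T−t)/r`, `y = x/(T−t)^{1/r}`,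
`u(x,t) = r⁻¹(T−t)^{1/r−1}U(y,s)`, `σ(x,t) = r⁻¹(T−t)^{1/r−1}S(y,s)`, where
`(U,S) = (Ũ,S̃) + X̂(Ū,S̄)` is controlled for ALL `s ≥ s₀` (i.e. all `t ∈ [0,T)`) by the bootstrap
Proposition 3.3 (p. 25; p. 40: "For such initial data we are under the hypothesis of
Proposition 3.3 for all `s₁ ≥ s₀`") and its consequences Lemmas 3.5–3.7 (pp. 25–27). The four
rate clauses below are READ OFF this construction; they are not displayed as a theorem in the
source:
* (Type I) Lemma 3.6, p. 26, second display: `|∇S| + |∇U| ≲ ⟨R/R₀⟩^{−r}` — an unweighted bound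
  `sup_{s ≥ s₀} sup_y (|∇_yU| + |∇_yS|) ≤ C'`. Since `∂_{xᵢ} = (T−t)^{−1/r}∂_{yᵢ}` and the
  amplitude is `r⁻¹(T−t)^{1/r−1}`, `∂ᵢu(x,t) = r⁻¹(T−t)^{−1}∂_{yᵢ}U(y,s)` and
  `∂ᵢ(ρ^{1/3})(x,t) = ∂ᵢ(σ/3) = (3r)⁻¹(T−t)^{−1}∂_{yᵢ}S(y,s)`: both are `≤ C/(T−t)`.
* (order `≤ 6`) Lemma 3.7, p. 27, second display:
  `|∇ʲU| + |∇ʲS| ≲_{δ₀,ε̄} ⟨R⟩^{−j(1−η)−(r−1)+ε̄}` for `1 ≤ j ≤ K−2` (weighted Gagliardo–Nirenberg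
  interpolation, Lemmas 4.4–4.6 pp. 50–52, between `E_K ≤ E` of Prop. 3.3 and the `L^∞`
  bounds), and `|U| + |S| ≲ 1` (Prop. 3.3 first line + (1.6), `j = 0`); `K` is "sufficiently
  large" (§3.2 p. 23: `… ≪ 1/K ≪ 1/m ≪ …`), in particular `K ≥ 8`. Hence
  `∇ⁿ_x u(·,t) = r⁻¹(T−t)^{1/r−1−n/r}(∇ⁿ_yU)(·,s)` and, by Leibniz for
  `ρ = ((3r)⁻¹(T−t)^{1/r−1}S)³`, `∇ⁿ_x ρ(·,t) = (3r)⁻³(T−t)^{3/r−3−n/r}∇ⁿ_y(S³)(·,s)` are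
  `O((T−t)^{−pₙ})` in sup norm for `n ≤ 6` (the periodic lift to `ℝ³` has the same sup).
* (floor) Lemma 3.5, p. 25, first display: `S ≳ δ₁⟨R/R₀⟩^{−(r−1)}` on `eˢ𝕋³_L`, where
  `R = |y| ≤ √3·L·eˢ`; so `S(·,s) ≳ δ₁(R₀/(√3L))^{r−1}e^{−(r−1)s} = c(T−t)^{(r−1)/r}` and
  `ρ^{1/3} = (3r)⁻¹(T−t)^{1/r−1}S ≥ c'`, i.e. `ρ ≥ c_l > 0` on `[0,T) × 𝕋³` (the far field of `S`
  is time-independent in physical variables, p. 26: `S(y,s) ≈ δ₀(y/y₀)^{−(r−1)}`); the clause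
  below allows a polynomial loss `(T−t)^{p_l}` and is implied (`p_l = 0`).
* (core) Thm 1.2 at `y = 0` with `S̄(0) > 0` ((1.5) p. 6): `(3r)³(T−t)^{3(1−1/r)}ρ(0,t) → S̄(0)³`,
  so `ρ(0,t) ≥ ½(3r)⁻³S̄(0)³(T−t)^{−β}`, `β = (1−1/r)/α = 3(1−1/r)`, for `t` near `T`, and
  `ρ(0,t) ≥ c_l ≥ c_l ε^β (T−t)^{−β}` on `[0, T−ε]` by the floor.
All four clauses keep their form under the scaling of Remark 1.4 (`T ↦ λ^{2α+1}T`, constants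
change) which brings the torus `𝕋³_L` to period `1`, and in the Euler case (Remark 1.5: same
proof minus the dissipation term; Lemmas 3.5–3.7 do not involve `ν`).

Deviations from print (all but the last are shared with `CaolaboraEtAl2025_thm12_euler`):
(i) unit torus `𝕋³ = UnitAddTorus (Fin 3)` (Rem 1.4: any period); (ii) Euler, `ν = 0` (Rem 1.5);
(iii) `γ = 5/3` only (`α = 1/3`, `1/α = 3`), with the Buckmaster–Cao-Labora–Gómez-Serrano profile
quoted on p. 6; (iv) "`C^∞` data + classical solution blowing up at `T`" rendered as a classical
solution on `[0,T) × 𝕋³` in the sense of `IsIsentropicEulerSolution (5/3) T ρ u` (joint smoothness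
on `Ico 0 T`, `ρ > 0`, pointwise equations (1.1) with `ν = 0`); (v) the finite-codimension
statement and the full self-similar limits are dropped; (vi) the four RATE clauses are
consequences of the construction (§1.3 ansatz + Prop. 3.3 + Lemmas 3.5–3.7 + Thm 1.2 at `y = 0`),
spelled out above, not a displayed theorem of the source — they are stated with unspecified
constants/exponents (`∃ C`, `∃ Cₙ pₙ`, `∃ c_l p_l`, `∃ c`), only the core exponent
`β = 3(1 − 1/r)`, `r > 1`, being pinned. Users take `(h : CaolaboraEtAl2025_thm12_rates)`.
[cite: CaolaboraEtAl2025, Thm 1.2 + Rem 1.4 + Rem 1.5 + Prop 3.3 + Lemmas 3.5-3.7 + (1.6)] -/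
def CaolaboraEtAl2025_thm12_rates : Prop :=
  ∃ (T r : ℝ), 0 < T ∧ 1 < r ∧ ∃ (ρ : ℝ → T3 → ℝ) (u : ℝ → T3 → V3),
    IsIsentropicEulerSolution (5 / 3) T ρ u ∧
    -- Type I: first derivatives of `u` and of `ρ^{1/3} = σ/3` are `O(1/(T−t))` in sup norm
    (∃ C : ℝ, ∀ t ∈ Ico 0 T, ∀ x, ∀ i : Fin 3,
        ‖Literature.Analysis.FunctionSpaces.Torus.partialDeriv i (u t) x‖ ≤ C / (T - t) ∧
        |Literature.Analysis.FunctionSpaces.Torus.partialDeriv i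
            (fun y => ρ t y ^ (1 / 3 : ℝ)) x| ≤ C / (T - t)) ∧
    -- polynomial sup bounds on all derivatives of order `≤ 6` of the periodic lifts
    (∀ n : ℕ, n ≤ 6 → ∃ Cn pn : ℝ, ∀ t ∈ Ico 0 T, ∀ y : EuclideanSpace ℝ (Fin 3),
        ‖iteratedFDeriv ℝ n (Literature.Analysis.FunctionSpaces.Torus.lift (ρ t)) y‖ ≤
            Cn * (T - t) ^ (-pn) ∧
        ‖iteratedFDeriv ℝ n (Literature.Analysis.FunctionSpaces.Torus.lift (u t)) y‖ ≤
            Cn * (T - t) ^ (-pn)) ∧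
    -- no vacuum, with at worst a polynomial loss
    (∃ cl pl : ℝ, 0 < cl ∧ ∀ t ∈ Ico 0 T, ∀ x, cl * (T - t) ^ pl ≤ ρ t x) ∧
    -- the core density grows at the self-similar rate `β = (1 − 1/r)/α = 3(1 − 1/r)`
    (∃ c : ℝ, 0 < c ∧ ∀ t ∈ Ico 0 T, ∃ x, c * (T - t) ^ (-(3 * (1 - 1 / r))) ≤ ρ t x)
-- TODO(general form): every `γ > 1` (`α = (γ−1)/2`, `ρ^α` in place of `ρ^{1/3}`, core exponent
-- `(1 − 1/r)/α`), the torus `𝕋³_L` of any period and `ℝ³` (Thm 1.3), Navier–Stokes `ν = 1` under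
-- `δ_dis = (r−1)/α + r − 2 > 0` (§1.3), the finite-codimension set of data, and the full
-- self-similar limits of Thm 1.2.

end Literature.Analysis.FluidPDE

end
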